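/-
Companion file of the Resolution Observatory cell (pub-rosobs), carver generation 47.  Statements OURS (the cell's
LEMMA RP, engine 1 generation 31); pure commutative algebra over an arbitrary commutative ring.  An INSTRUMENT of the
cell's normal-form bookkeeping for maximal weighted centres — NOT a resolution theorem.
-/
import Mathlib.Algebra.Polynomial.Expand
import Literature.AlgebraicGeometry.Resolution.WeightedCentreCleanLayers

/-!
# Reparametrisation of a layered shift (LEMMA RP of the weighted-centre normal-form algorithm)

Continuation of `WeightedCentreCleanLayers`: `A = R[ε_i : i ∈ ι]`, a shift `Δ : ι → A[σ]`, the substitution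
`layerSubst Δ : g ↦ g(ε + Δ)` and its layers.  If every `σ`-exponent occurring in `Δ` is divisible by `d ≥ 1`
then `Δ_i = Δ̃_i(σ^d)` with `Δ̃_i = contract_d Δ_i`, and `g(ε + Δ) = (g(ε + Δ̃))(σ^d)` (`layerSubst_expand`).
Since `F ↦ F(σ^d)` (`Polynomial.expand`, i.e. `k[u] → k[σ]`, `u ↦ σ^d`) is injective:

* `layerSubst_expand_eq_C_iff`, `layerSubst_eq_C_iff_contract` (LEMMA RP): `g` is invariant under
  `ε ↦ ε + Δ(σ)` iff it is invariant under the REPARAMETRISED shift `ε ↦ ε + Δ̃(u)` — a graded isotropy whose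
  shift only involves `σ^d` may be reparametrised by `u = σ^d` (the cell's LEMMA RP, engine 1 gen 31, used to make
  the layer indices of an isotropy coprime before PURGE);
* `isLayerIndex_expand_iff`: the layer `d·t` of `Δ̃(σ^d)` is the layer `t` of `Δ̃`;
* `isCleanLayer_expand_iff`: `d·s` is clean for `Δ̃(σ^d)` iff `s` is clean for `Δ̃`, so LEMMA LD
  (`coeff_layerSubst_of_isCleanLayer`) transports along the reparametrisation.

The graded bookkeeping of RP (`deg u = d·deg σ`) is not modelled here (the weights live in the cell's `W(f)` files).
Print anchor of the underlying Taylor-expansion formalism: [CossartJannsenSaito2020, Ch. 14, proof of Lemma 14.10].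
-/

noncomputable section

open MvPolynomial

namespace Literature.AlgebraicGeometry.Resolution.WeightedBlowup

variable {R : Type*} [CommRing R] {ι : Type*}

section Reparam

variable (d : ℕ) (Δ : ι → Polynomial (MvPolynomial ι R))

/-- `g(ε + Δ(σ^d)) = (g(ε + Δ))(σ^d)`: substitution commutes with the reparametrisation `σ ↦ σ^d`. (derived here)
[cite: CossartJannsenSaito2020, Ch. 14, proof of Lemma 14.10 (p. 170)] -/
theorem layerSubst_expand (g : MvPolynomial ι R) :
    layerSubst (fun i => Polynomial.expand _ d (Δ i)) g = Polynomial.expand _ d (layerSubst Δ g) := by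
  induction g using MvPolynomial.induction_on with
  | C a => rw [layerSubst_C, layerSubst_C, Polynomial.expand_C]
  | add p q hp hq => rw [map_add, map_add, map_add, hp, hq]
  | mul_X p j hp =>
    rw [map_mul, map_mul, map_mul, hp, layerSubst_X, layerSubst_X, map_add, Polynomial.expand_C]

/-- **LEMMA RP (core).**  For `d ≥ 1`, `g` is invariant under `ε ↦ ε + Δ(σ^d)` iff it is invariant under
`ε ↦ ε + Δ(σ)`: a graded isotropy whose shifts only involve `σ^d` may be reparametrised by `u = σ^d`
(`k[u] → k[σ]`, `u ↦ σ^d`, is injective). (the cell's LEMMA RP, engine 1 gen 31; derived here)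
[cite: CossartJannsenSaito2020, Ch. 14, proof of Lemma 14.10 (p. 170)] -/
theorem layerSubst_expand_eq_C_iff (hd : 0 < d) (g : MvPolynomial ι R) :
    layerSubst (fun i => Polynomial.expand _ d (Δ i)) g = Polynomial.C g ↔
      layerSubst Δ g = Polynomial.C g := by
  rw [layerSubst_expand, ← Polynomial.expand_C d g, (Polynomial.expand_injective hd).eq_iff,
    Polynomial.expand_C]

/-- A polynomial all of whose exponents are divisible by `d ≠ 0` is the expansion of its contraction.
(plumbing, derived here) [cite: CossartJannsenSaito2020, Ch. 14, proof of Lemma 14.10 (p. 170)] -/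
theorem expand_contract_of_dvd {A : Type*} [CommSemiring A] {d : ℕ} (hd : d ≠ 0) {f : Polynomial A}
    (hf : ∀ n, f.coeff n ≠ 0 → d ∣ n) : Polynomial.expand A d (Polynomial.contract d f) = f := by
  ext n
  rw [Polynomial.coeff_expand (Nat.pos_of_ne_zero hd), Polynomial.coeff_contract hd]
  split_ifs with h
  · rw [Nat.div_mul_cancel h]
  · by_contra hne
    exact h (hf n (Ne.symm hne))

/-- **LEMMA RP (layer form).**  If every layer index of `Δ` is divisible by `d ≥ 1` then, with the contracted
shift `Δ̃_i = contract_d Δ_i` (so `Δ_i = Δ̃_i(σ^d)`), `g` is `Φ_Δ`-invariant iff it is `Φ_Δ̃`-invariant.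
(derived here) [cite: CossartJannsenSaito2020, Ch. 14, proof of Lemma 14.10 (p. 170)] -/
theorem layerSubst_eq_C_iff_contract (hd : 0 < d) (hdiv : ∀ t, IsLayerIndex Δ t → d ∣ t)
    (g : MvPolynomial ι R) :
    layerSubst Δ g = Polynomial.C g ↔
      layerSubst (fun i => Polynomial.contract d (Δ i)) g = Polynomial.C g := by
  have hΔ : (fun i => Polynomial.expand _ d (Polynomial.contract d (Δ i))) = Δ := by
    funext i
    exact expand_contract_of_dvd (Nat.pos_iff_ne_zero.1 hd) fun n hn => hdiv n ⟨i, hn⟩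
  rw [← layerSubst_expand_eq_C_iff d (fun i => Polynomial.contract d (Δ i)) hd, hΔ]

/-- Layers under reparametrisation: `t` is a layer index of `Δ(σ^d)` iff `d ∣ t` and `t / d` is a layer index
of `Δ`. (plumbing, derived here) [cite: CossartJannsenSaito2020, Ch. 14, proof of Lemma 14.10 (p. 170)] -/
theorem isLayerIndex_expand_iff (hd : 0 < d) (t : ℕ) :
    IsLayerIndex (fun i => Polynomial.expand _ d (Δ i)) t ↔ d ∣ t ∧ IsLayerIndex Δ (t / d) := by
  simp only [IsLayerIndex, Polynomial.coeff_expand hd]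
  constructor
  · rintro ⟨i, hi⟩
    by_cases h : d ∣ t
    · rw [if_pos h] at hi
      exact ⟨h, i, hi⟩
    · rw [if_neg h] at hi
      exact absurd rfl hi
  · rintro ⟨h, i, hi⟩
    exact ⟨i, by rwa [if_pos h]⟩

/-- The reparametrised shift again has no layer `0`. (plumbing, derived here)
[cite: CossartJannsenSaito2020, Ch. 14, proof of Lemma 14.10 (p. 170)] -/
theorem coeff_zero_expand_eq_zero (hd : 0 < d) (h0 : ∀ i, (Δ i).coeff 0 = 0) (i : ι) :
    (Polynomial.expand _ d (Δ i)).coeff 0 = 0 := by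
  rw [Polynomial.coeff_expand hd, if_pos (dvd_zero d), Nat.zero_div, h0]

/-- Clean layers under reparametrisation: `d·s` is clean for `Δ(σ^d)` iff `s` is clean for `Δ` (`d ≥ 1`).
(derived here) [cite: CossartJannsenSaito2020, Ch. 14, proof of Lemma 14.10 (p. 170)] -/
theorem isCleanLayer_expand_iff (hd : 0 < d) (s : ℕ) :
    IsCleanLayer (fun i => Polynomial.expand _ d (Δ i)) (d * s) ↔ IsCleanLayer Δ s := by
  constructor
  · intro h T hT hsum
    have := h (T.map (d * ·)) (fun t ht => ?_) ?_
    · rwa [Multiset.card_map] at this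
    · obtain ⟨u, hu, rfl⟩ := Multiset.mem_map.1 ht
      exact (isLayerIndex_expand_iff d Δ hd _).2
        ⟨dvd_mul_right d u, by rw [Nat.mul_div_cancel_left u hd]; exact hT u hu⟩
    · rw [Multiset.sum_map_mul_left, Multiset.map_id', hsum]
  · intro h T hT hsum
    have hdvd : ∀ t ∈ T, d ∣ t := fun t ht => ((isLayerIndex_expand_iff d Δ hd t).1 (hT t ht)).1
    have hT' : T = (T.map (· / d)).map (d * ·) := by
      rw [Multiset.map_map]
      conv_lhs => rw [← Multiset.map_id T]
      refine Multiset.map_congr rfl fun t ht => ?_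
      simp only [Function.comp_apply, id]
      rw [Nat.mul_div_cancel' (hdvd t ht)]
    have hsum' : (T.map (· / d)).sum = s := by
      have h1 : T.sum = d * (T.map (· / d)).sum := by
        conv_lhs => rw [hT']
        rw [Multiset.sum_map_mul_left, Multiset.map_id']
      rw [hsum] at h1
      exact (Nat.eq_of_mul_eq_mul_left hd h1).symm
    have := h (T.map (· / d)) (fun u hu => ?_) hsum'
    · rwa [Multiset.card_map] at this
    · obtain ⟨t, ht, rfl⟩ := Multiset.mem_map.1 hu
      exact ((isLayerIndex_expand_iff d Δ hd t).1 (hT t ht)).2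

end Reparam

end Literature.AlgebraicGeometry.Resolution.WeightedBlowup

end
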